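import Literature.NumberTheory.GaloisRepresentations.LiftingRingPoints
import Literature.NumberTheory.GaloisRepresentations.CompleteLocalFiniteLevels
import Mathlib.Analysis.SpecificLimits.Basic
import Literature.AlgebraicGeometry.Resolution.FormalEquidimensionality
import Mathlib.RingTheory.RegularLocalRing.Defs
import HarnessLib

/-!
# Rigidity of pointwise lifting rings: "uniquely characterized by its `ℚ̄_l`-points" ([BLGGT] §1.4)

Let `L/ℚ_p` be finite inside `ℚ̄_p`, `𝒪 = 𝒪_L`, `k` a finite field receiving `𝒪` onto (the
residue field `k_L`), `Γ` a topological group, `ρ̄ : Γ → GL_n(k)` continuous and `𝒞` a condition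
on continuous `ρ : Γ → GL_n(ℚ̄_p)`. The accepted interface `PointwiseLiftingRing Γ p 𝒪 k ρ̄ 𝒞`
axiomatises the quotient `R^□_{𝒪,ρ̄,𝒞}` of the universal lifting ring "uniquely characterized by
requiring that [it is] reduced without `l`-torsion and that a `ℚ̄_l`-point of `R^□_{𝒪,ρ̄}` factors
through [it] if and only if it corresponds to a representation … which has [the] property"
([BLGGT] §1.4, p. 13) — WITHOUT constructing `R^□_{𝒪,ρ̄}`. This file PROVES the uniqueness
inside the interface:

* `PointwiseLiftingRing.algEquiv 𝓡₁ 𝓡₂ : 𝓡₁.R ≃ₐ[𝒪] 𝓡₂.R` with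
  `PointwiseLiftingRing.algEquiv_lift : algEquiv (lift₁ γ)_{ij} = (lift₂ γ)_{ij}` — **any two
  instances with the same parameters are isomorphic, compatibly with their liftings.**

Consequently every property of "the" ring that is invariant under such isomorphisms — e.g. Kisin's
"`R[1/p]` is regular and equidimensional of a given dimension" (the accepted predicate
`PstWeilDeligneData.CrystallineGenericFibreRegular` quantifies over ALL instances) — holds for
all instances as soon as it holds for one (`isRegularRing_away_of_algEquiv`,
`forall_ringKrullDim_quotient_minimalPrimes_away_of_algEquiv`, `genericFibre_transport`).

## Proof

No universal lifting ring is needed. Put `A ⊆ R₁ × R₂` := the `𝒪`-subalgebra generated by the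
paired entries `((lift₁ γ)_{ij}, (lift₂ γ)_{ij})` (`jointSubalgebra`) and `R₃` := its closure
for the product of the `𝔪`-adic topologies (`jointClosure`, phrased through the levels `𝔪ᵐ`).
(1) For a pair of points `x₁, x₂` with `x₁ ∘ lift₁ = x₂ ∘ lift₂` one has `x₁ s.1 = x₂ s.2` on `A`
(`apply_fst_eq_apply_snd_of_mem_jointSubalgebra`), hence — points being CONTINUOUS
(`exists_norm_pow_le`: `‖x a‖ ≤ cᴺ` on `𝔪ᴺ`, accepted `FrameRingPoints`) — `x₂ z.2 = 0`
whenever `z ∈ R₃` has `z.1 = 0`; as every point `x₂` of `R₂` pairs with the point `x₁` of `R₁`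
defined by the `𝒞`-lift `x₂ ∘ lift₂` (`existsUnique_point`), and points SEPARATE elements
(accepted `eq_zero_of_forall_algHom_eq_zero`, file `LiftingRingPoints`), the projection
`R₃ → R₁` is injective; symmetrically for `R₃ → R₂`. (2) `R₃ → R₁` is onto: `A → R₁` has dense
image (`exists_sub_mem`), and a sequence in `R₂` has an `𝔪`-adic cluster point because `R₂` is
complete with FINITE levels `R₂/𝔪ᵐ` (accepted `CompleteLocalRing.finite_quotient_maximalIdeal_pow`,
`limOfCompatible`; the sequential-compactness lemma `CompleteLocalRing.exists_adicClusterPt`).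
(3) `R₁ ≅ R₃ ≅ R₂`.

No named facts, no `sorry`.

## References

* [BLGGT] T. Barnet-Lamb, T. Gee, D. Geraghty, R. Taylor, *Potential automorphy and change of
  weight*, Ann. of Math. 179 (2014), §1.2–1.4 (pp. 11–14 of arXiv:1010.2561). [BarnetlambEtAl2014]
* M. Kisin, *Potentially semi-stable deformation rings*, JAMS 21 (2008), (3.3.3), Thm. (3.3.8).
  [Kisin2007]
* H. Matsumura, *Commutative Ring Theory*, CUP 1986, §8. [Matsumura1987]
-/

noncomputable section

open IsLocalRing Filter Topology
open scoped MatrixGroups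

namespace Literature.NumberTheory.GaloisRepresentations

/-! ### Sequential compactness of complete noetherian local rings with finite residue field -/

namespace CompleteLocalRing

variable {R : Type*} [CommRing R] [IsLocalRing R] [IsNoetherianRing R] [Finite (ResidueField R)]

/-- One step of the extraction: if a residue `y mod 𝔪ᵐ` is attained by the sequence `u`
infinitely often, so is some residue `y' mod 𝔪ᵐ⁺¹` above it (pigeonhole in the finite fibre).
[folklore] -/
theorem exists_frequently_factor_eq (u : ℕ → R) (m : ℕ) (y : R ⧸ maximalIdeal R ^ m)
    (hy : ∀ M₀ : ℕ, ∃ m' ≥ M₀, Ideal.Quotient.mk (maximalIdeal R ^ m) (u m') = y) :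
    ∃ y' : R ⧸ maximalIdeal R ^ (m + 1),
      Ideal.Quotient.factor (Ideal.pow_le_pow_right (Nat.le_succ m)) y' = y ∧
        ∀ M₀ : ℕ, ∃ m' ≥ M₀, Ideal.Quotient.mk (maximalIdeal R ^ (m + 1)) (u m') = y' := by
  classical
  haveI := finite_quotient_maximalIdeal_pow (R := R) (m + 1)
  haveI : Fintype (R ⧸ maximalIdeal R ^ (m + 1)) := Fintype.ofFinite _
  by_contra hcon
  -- every residue above `y` is attained only finitely often
  have hfin : ∀ y' : R ⧸ maximalIdeal R ^ (m + 1),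
      Ideal.Quotient.factor (Ideal.pow_le_pow_right (Nat.le_succ m)) y' = y →
        ∃ M : ℕ, ∀ m' ≥ M, Ideal.Quotient.mk (maximalIdeal R ^ (m + 1)) (u m') ≠ y' := by
    intro y' hy'
    by_contra h
    apply hcon
    refine ⟨y', hy', fun M₀ => ?_⟩
    by_contra h'
    apply h
    refine ⟨M₀, fun m' hm' heq => h' ⟨m', hm', heq⟩⟩
  -- a uniform bound over the finite fibre
  let M : (R ⧸ maximalIdeal R ^ (m + 1)) → ℕ := fun y' =>
    if h : Ideal.Quotient.factor (Ideal.pow_le_pow_right (Nat.le_succ m)) y' = y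
    then (hfin y' h).choose else 0
  have hM : ∀ y', (h : Ideal.Quotient.factor (Ideal.pow_le_pow_right (Nat.le_succ m)) y' = y) →
      ∀ m' ≥ M y', Ideal.Quotient.mk (maximalIdeal R ^ (m + 1)) (u m') ≠ y' := by
    intro y' h m' hm'
    have := (hfin y' h).choose_spec m' (by simpa [M, h] using hm')
    exact this
  obtain ⟨m', hm', hym'⟩ := hy (Finset.univ.sup M)
  set y'' := Ideal.Quotient.mk (maximalIdeal R ^ (m + 1)) (u m') with hy''
  have hfac : Ideal.Quotient.factor (Ideal.pow_le_pow_right (Nat.le_succ m)) y'' = y := by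
    rw [hy'', Ideal.Quotient.factor_mk, hym']
  exact hM y'' hfac m' ((Finset.le_sup (Finset.mem_univ y'')).trans hm') rfl

/-- **Sequential compactness in level form**: every sequence `u` in a complete noetherian local
ring with finite residue field has an `𝔪`-adic cluster point `b` — at every level `𝔪ᵐ`,
`u m' ≡ b` for infinitely many `m'`. (The ring is profinite: `R = lim R/𝔪ᵐ` with finite levels.)
[cite: Matsumura1987, §8] -/
theorem exists_adicClusterPt [IsAdicComplete (maximalIdeal R) R] (u : ℕ → R) :
    ∃ b : R, ∀ m M₀ : ℕ, ∃ m' ≥ M₀, u m' - b ∈ maximalIdeal R ^ m := by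
  classical
  -- the type of frequently attained residues at level `m`
  let Freq : (m : ℕ) → (R ⧸ maximalIdeal R ^ m) → Prop := fun m y =>
    ∀ M₀ : ℕ, ∃ m' ≥ M₀, Ideal.Quotient.mk (maximalIdeal R ^ m) (u m') = y
  have h0 : Freq 0 (Ideal.Quotient.mk _ 0) := fun M₀ => ⟨M₀, le_rfl, by
    haveI : Subsingleton (R ⧸ maximalIdeal R ^ 0) := by
      rw [pow_zero, Ideal.one_eq_top]
      exact Ideal.Quotient.subsingleton_iff.2 rfl
    exact Subsingleton.elim _ _⟩
  -- the recursive choice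
  let step : (m : ℕ) → {y : R ⧸ maximalIdeal R ^ m // Freq m y} →
      {y : R ⧸ maximalIdeal R ^ (m + 1) // Freq (m + 1) y} := fun m yy =>
    ⟨(exists_frequently_factor_eq u m yy.1 yy.2).choose,
      (exists_frequently_factor_eq u m yy.1 yy.2).choose_spec.2⟩
  have hstep : ∀ (m : ℕ) (yy : {y : R ⧸ maximalIdeal R ^ m // Freq m y}),
      Ideal.Quotient.factor (Ideal.pow_le_pow_right (Nat.le_succ m)) (step m yy).1 = yy.1 :=
    fun m yy => (exists_frequently_factor_eq u m yy.1 yy.2).choose_spec.1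
  let sq : (m : ℕ) → {y : R ⧸ maximalIdeal R ^ m // Freq m y} := fun m =>
    Nat.rec (motive := fun m => {y : R ⧸ maximalIdeal R ^ m // Freq m y}) ⟨_, h0⟩ step m
  have hsq : ∀ m, sq (m + 1) = step m (sq m) := fun m => rfl
  have hcompat : ∀ m, Ideal.Quotient.factor (Ideal.pow_le_pow_right (Nat.le_succ m))
      (sq (m + 1)).1 = (sq m).1 := fun m => by
    rw [hsq]
    exact hstep m (sq m)
  refine ⟨limOfCompatible (maximalIdeal R) (fun m => (sq m).1) hcompat, fun m M₀ => ?_⟩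
  obtain ⟨m', hm', heq⟩ := (sq m).2 M₀
  refine ⟨m', hm', ?_⟩
  rw [← Ideal.Quotient.eq, heq, mk_limOfCompatible]

end CompleteLocalRing

/-! ### Points of pointwise lifting rings over `𝒪_L`: residue surjectivity, bounds, continuity -/

namespace PointwiseLiftingRing

variable {Γ : Type} [Group Γ] [TopologicalSpace Γ] {p : ℕ} [Fact p.Prime]
  (L : IntermediateField ℚ_[p] (PadicAlgCl p)) [FiniteDimensional ℚ_[p] L]
  [Algebra (intermediateFieldIntegers p L) (PadicAlgCl p)]
  [IsScalarTower (intermediateFieldIntegers p L) L (PadicAlgCl p)]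
  {k : Type} [Field k] [Algebra (intermediateFieldIntegers p L) k] [TopologicalSpace k]
  {n : ℕ} {ρbar : Γ →ₜ* GL (Fin n) k} {C : FramedRep Γ (PadicAlgCl p) n → Prop}

section OneRing

variable (𝓡 : PointwiseLiftingRing Γ p (intermediateFieldIntegers p L) k ρbar C)

omit [FiniteDimensional ℚ_[p] L] [IsScalarTower (intermediateFieldIntegers p L) L (PadicAlgCl p)] in
/-- If `𝒪_L → k` is onto, then `𝒪_L → R → R/𝔪_R` is onto (the residue field of `R` is `k`).
[folklore] -/
theorem residue_comp_algebraMap_surjective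
    (hk : Function.Surjective (algebraMap (intermediateFieldIntegers p L) k)) :
    Function.Surjective ((residue 𝓡.R).comp (algebraMap (intermediateFieldIntegers p L) 𝓡.R)) := by
  intro z
  obtain ⟨r, rfl⟩ := residue_surjective z
  obtain ⟨a, ha⟩ := hk (𝓡.residueMap r)
  refine ⟨a, ?_⟩
  rw [RingHom.comp_apply, ← sub_eq_zero, ← map_sub, residue_eq_zero_iff, ← 𝓡.ker_residueMap hk,
    RingHom.mem_ker, map_sub, sub_eq_zero]
  rw [← ha]
  exact 𝓡.residueMap.commutes a

omit [FiniteDimensional ℚ_[p] L] [IsScalarTower (intermediateFieldIntegers p L) L (PadicAlgCl p)] in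
/-- If `𝒪_L → k` is onto and `k` is finite, the residue field of `R` is finite. [folklore] -/
theorem finite_residueField [Finite k]
    (hk : Function.Surjective (algebraMap (intermediateFieldIntegers p L) k)) :
    Finite (ResidueField 𝓡.R) := by
  classical
  let f : k → ResidueField 𝓡.R := fun c =>
    residue 𝓡.R (algebraMap (intermediateFieldIntegers p L) 𝓡.R (hk c).choose)
  refine Finite.of_surjective f fun z => ?_
  obtain ⟨a, rfl⟩ := 𝓡.residue_comp_algebraMap_surjective L hk z
  refine ⟨algebraMap (intermediateFieldIntegers p L) k a, ?_⟩
  simp only [f, RingHom.comp_apply]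
  set a' := (hk (algebraMap (intermediateFieldIntegers p L) k a)).choose with ha'
  have h' : algebraMap (intermediateFieldIntegers p L) k a' =
      algebraMap (intermediateFieldIntegers p L) k a :=
    (hk (algebraMap (intermediateFieldIntegers p L) k a)).choose_spec
  rw [← sub_eq_zero, ← map_sub, residue_eq_zero_iff, ← 𝓡.ker_residueMap hk, RingHom.mem_ker,
    map_sub, sub_eq_zero, 𝓡.residueMap.commutes, 𝓡.residueMap.commutes, h']

omit [FiniteDimensional ℚ_[p] L] in
/-- Points of `R` are `𝒪_{ℚ̄_p}`-valued. [cite: BarnetlambEtAl2014, §1.2] -/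
theorem norm_point_le_one (hk : Function.Surjective (algebraMap (intermediateFieldIntegers p L) k))
    (x : 𝓡.R →ₐ[intermediateFieldIntegers p L] PadicAlgCl p) (r : 𝓡.R) : ‖x r‖ ≤ 1 :=
  norm_map_le_one L x
    (exists_sub_algebraMap_mem_maximalIdeal L (𝓡.residue_comp_algebraMap_surjective L hk)) r

omit [FiniteDimensional ℚ_[p] L] in
/-- **Continuity estimate for points**: there is `c < 1` with `‖x a‖ ≤ cᴺ` for all `a ∈ 𝔪_Rᴺ`
(`𝔪_R` is finitely generated and each generator goes to the open unit ball).
[cite: BarnetlambEtAl2014, §1.2] -/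
theorem exists_norm_pow_le (hk : Function.Surjective (algebraMap (intermediateFieldIntegers p L) k))
    (x : 𝓡.R →ₐ[intermediateFieldIntegers p L] PadicAlgCl p) :
    ∃ c : ℝ, 0 ≤ c ∧ c < 1 ∧ ∀ (N : ℕ) (a : 𝓡.R), a ∈ maximalIdeal 𝓡.R ^ N → ‖x a‖ ≤ c ^ N := by
  classical
  have hR := 𝓡.norm_point_le_one L hk x
  obtain ⟨G, hG⟩ := IsNoetherian.noetherian (maximalIdeal 𝓡.R)
  -- a uniform bound `c < 1` on the finitely many generators
  have hgen : ∀ g ∈ G, ‖x g‖ < 1 := fun g hg =>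
    norm_map_lt_one_of_mem_maximalIdeal L x (hG ▸ Ideal.subset_span hg)
  have hmax : ∃ c : ℝ, 0 ≤ c ∧ c < 1 ∧ ∀ g ∈ G, ‖x g‖ ≤ c := by
    clear hG
    induction G using Finset.induction_on with
    | empty => exact ⟨0, le_rfl, zero_lt_one, fun g hg => absurd hg (Finset.notMem_empty g)⟩
    | insert g G hgG ih =>
      obtain ⟨c, hc0, hc1, hc⟩ := ih fun g' hg' => hgen g' (Finset.mem_insert_of_mem hg')
      refine ⟨max c ‖x g‖, hc0.trans (le_max_left _ _),
        max_lt hc1 (hgen g (Finset.mem_insert_self g G)), fun g' hg' => ?_⟩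
      rcases Finset.mem_insert.mp hg' with rfl | hg'
      · exact le_max_right _ _
      · exact (hc g' hg').trans (le_max_left _ _)
  obtain ⟨c, hc0, hc1, hc⟩ := hmax
  refine ⟨c, hc0, hc1, fun N a ha => ?_⟩
  refine norm_map_le_pow_of_mem_pow L x hc0 (fun b hb => ?_) N ha hR
  have hb' : b ∈ Ideal.span (G : Set 𝓡.R) := by
    show b ∈ Submodule.span 𝓡.R (G : Set 𝓡.R)
    rw [hG]
    exact hb
  exact norm_map_le_of_mem_span L x hR hc0 (fun g hg => hc g hg) hb'

omit [FiniteDimensional ℚ_[p] L] [IsScalarTower (intermediateFieldIntegers p L) L (PadicAlgCl p)] in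
/-- Entrywise form of `specialize x = specialize y`-type identities: the point attached by `𝓡₁`
to the lift defined by a point `x₂` of `𝓡₂` agrees with `x₂` on paired entries. [folklore] -/
theorem pointOf_liftAt_apply (𝓡₁ 𝓡₂ : PointwiseLiftingRing Γ p (intermediateFieldIntegers p L) k ρbar C)
    (x₂ : 𝓡₂.R →ₐ[intermediateFieldIntegers p L] PadicAlgCl p) (γ : Γ) (i j : Fin n) :
    𝓡₁.pointOf (𝓡₂.liftAt x₂) (𝓡₂.reducesTo_liftAt x₂) (𝓡₂.cond_liftAt x₂)
        ((𝓡₁.lift γ : Matrix (Fin n) (Fin n) 𝓡₁.R) i j) =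
      x₂ ((𝓡₂.lift γ : Matrix (Fin n) (Fin n) 𝓡₂.R) i j) := by
  have h := 𝓡₁.specialize_pointOf (𝓡₂.liftAt x₂) (𝓡₂.reducesTo_liftAt x₂) (𝓡₂.cond_liftAt x₂)
  have h' := congrArg (fun f : Γ →* GL (Fin n) (PadicAlgCl p) =>
    ((f γ : GL (Fin n) (PadicAlgCl p)) : Matrix (Fin n) (Fin n) (PadicAlgCl p)) i j) h
  simpa only [liftAt_toMonoidHom, coe_specialize_apply, Matrix.map_apply, AlgHom.coe_toRingHom,
    RingHom.coe_coe] using h'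

end OneRing

/-! ### The joint subalgebra and its closure -/

section TwoRings

variable (𝓡₁ 𝓡₂ : PointwiseLiftingRing Γ p (intermediateFieldIntegers p L) k ρbar C)

/-- The paired entries `((lift₁ γ)_{ij}, (lift₂ γ)_{ij}) ∈ R₁ × R₂`. [folklore] -/
def jointGen (t : Γ × Fin n × Fin n) : 𝓡₁.R × 𝓡₂.R :=
  ((𝓡₁.lift t.1 : Matrix (Fin n) (Fin n) 𝓡₁.R) t.2.1 t.2.2,
    (𝓡₂.lift t.1 : Matrix (Fin n) (Fin n) 𝓡₂.R) t.2.1 t.2.2)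

/-- The `𝒪`-subalgebra `A ⊆ R₁ × R₂` generated by the paired entries. [folklore] -/
def jointSubalgebra : Subalgebra (intermediateFieldIntegers p L) (𝓡₁.R × 𝓡₂.R) :=
  Algebra.adjoin (intermediateFieldIntegers p L) (Set.range (jointGen L 𝓡₁ 𝓡₂))

omit [FiniteDimensional ℚ_[p] L] [IsScalarTower (intermediateFieldIntegers p L) L (PadicAlgCl p)] in
/-- The first projection of `A` is `𝒪[entries of lift₁]`. [folklore] -/
theorem map_fst_jointSubalgebra :
    (jointSubalgebra L 𝓡₁ 𝓡₂).map (AlgHom.fst (intermediateFieldIntegers p L) 𝓡₁.R 𝓡₂.R) =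
      Algebra.adjoin (intermediateFieldIntegers p L) 𝓡₁.entries := by
  rw [jointSubalgebra, AlgHom.map_adjoin, ← Set.range_comp]
  rfl

omit [FiniteDimensional ℚ_[p] L] [IsScalarTower (intermediateFieldIntegers p L) L (PadicAlgCl p)] in
/-- The second projection of `A` is `𝒪[entries of lift₂]`. [folklore] -/
theorem map_snd_jointSubalgebra :
    (jointSubalgebra L 𝓡₁ 𝓡₂).map (AlgHom.snd (intermediateFieldIntegers p L) 𝓡₁.R 𝓡₂.R) =
      Algebra.adjoin (intermediateFieldIntegers p L) 𝓡₂.entries := by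
  rw [jointSubalgebra, AlgHom.map_adjoin, ← Set.range_comp]
  rfl

omit [FiniteDimensional ℚ_[p] L] [IsScalarTower (intermediateFieldIntegers p L) L (PadicAlgCl p)] in
/-- **Agreement on `A`**: two points `x₁`, `x₂` that agree on paired entries agree on `A`
(`x₁ s.1 = x₂ s.2`). [folklore] -/
theorem apply_fst_eq_apply_snd_of_mem_jointSubalgebra
    {x₁ : 𝓡₁.R →ₐ[intermediateFieldIntegers p L] PadicAlgCl p}
    {x₂ : 𝓡₂.R →ₐ[intermediateFieldIntegers p L] PadicAlgCl p}
    (hx : ∀ (γ : Γ) (i j : Fin n), x₁ ((𝓡₁.lift γ : Matrix (Fin n) (Fin n) 𝓡₁.R) i j) =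
      x₂ ((𝓡₂.lift γ : Matrix (Fin n) (Fin n) 𝓡₂.R) i j))
    {s : 𝓡₁.R × 𝓡₂.R} (hs : s ∈ jointSubalgebra L 𝓡₁ 𝓡₂) : x₁ s.1 = x₂ s.2 := by
  let φ₁ := x₁.comp (AlgHom.fst (intermediateFieldIntegers p L) 𝓡₁.R 𝓡₂.R)
  let φ₂ := x₂.comp (AlgHom.snd (intermediateFieldIntegers p L) 𝓡₁.R 𝓡₂.R)
  have hle : jointSubalgebra L 𝓡₁ 𝓡₂ ≤ AlgHom.equalizer φ₁ φ₂ := by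
    refine Algebra.adjoin_le ?_
    rintro _ ⟨⟨γ, i, j⟩, rfl⟩
    rw [SetLike.mem_coe, AlgHom.mem_equalizer]
    exact hx γ i j
  have := (AlgHom.mem_equalizer φ₁ φ₂ s).mp (hle hs)
  exact this

/-- Membership in the closure `R₃` of `A` for the product of the `𝔪`-adic topologies: at every
level there is an element of `A` congruent to `z` in both coordinates. [folklore] -/
def JointMem (z : 𝓡₁.R × 𝓡₂.R) : Prop :=
  ∀ m : ℕ, ∃ s ∈ jointSubalgebra L 𝓡₁ 𝓡₂,
    z.1 - s.1 ∈ maximalIdeal 𝓡₁.R ^ m ∧ z.2 - s.2 ∈ maximalIdeal 𝓡₂.R ^ m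

omit [FiniteDimensional ℚ_[p] L] [IsScalarTower (intermediateFieldIntegers p L) L (PadicAlgCl p)] in
/-- Elements of `A` lie in its closure. [folklore] -/
theorem jointMem_of_mem {s : 𝓡₁.R × 𝓡₂.R} (hs : s ∈ jointSubalgebra L 𝓡₁ 𝓡₂) :
    JointMem L 𝓡₁ 𝓡₂ s := fun m =>
  ⟨s, hs, by rw [sub_self]; exact Ideal.zero_mem _, by rw [sub_self]; exact Ideal.zero_mem _⟩

/-- **The closure `R₃` of `A` in `R₁ × R₂`**, an `𝒪`-subalgebra. [folklore] -/
def jointClosure : Subalgebra (intermediateFieldIntegers p L) (𝓡₁.R × 𝓡₂.R) where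
  carrier := {z | JointMem L 𝓡₁ 𝓡₂ z}
  mul_mem' {z w} hz hw m := by
    obtain ⟨s, hs, hs1, hs2⟩ := hz m
    obtain ⟨t, ht, ht1, ht2⟩ := hw m
    refine ⟨s * t, Subalgebra.mul_mem _ hs ht, ?_, ?_⟩
    · have : (z * w).1 - (s * t).1 = z.1 * (w.1 - t.1) + (z.1 - s.1) * t.1 := by
        simp only [Prod.fst_mul]; ring
      rw [this]
      exact Ideal.add_mem _ (Ideal.mul_mem_left _ _ ht1) (Ideal.mul_mem_right _ _ hs1)
    · have : (z * w).2 - (s * t).2 = z.2 * (w.2 - t.2) + (z.2 - s.2) * t.2 := by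
        simp only [Prod.snd_mul]; ring
      rw [this]
      exact Ideal.add_mem _ (Ideal.mul_mem_left _ _ ht2) (Ideal.mul_mem_right _ _ hs2)
  one_mem' := jointMem_of_mem L 𝓡₁ 𝓡₂ (Subalgebra.one_mem _)
  add_mem' {z w} hz hw m := by
    obtain ⟨s, hs, hs1, hs2⟩ := hz m
    obtain ⟨t, ht, ht1, ht2⟩ := hw m
    refine ⟨s + t, Subalgebra.add_mem _ hs ht, ?_, ?_⟩
    · have : (z + w).1 - (s + t).1 = (z.1 - s.1) + (w.1 - t.1) := by
        simp only [Prod.fst_add]; ring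
      rw [this]
      exact Ideal.add_mem _ hs1 ht1
    · have : (z + w).2 - (s + t).2 = (z.2 - s.2) + (w.2 - t.2) := by
        simp only [Prod.snd_add]; ring
      rw [this]
      exact Ideal.add_mem _ hs2 ht2
  zero_mem' := jointMem_of_mem L 𝓡₁ 𝓡₂ (Subalgebra.zero_mem _)
  algebraMap_mem' a := jointMem_of_mem L 𝓡₁ 𝓡₂ (Subalgebra.algebraMap_mem _ a)

omit [FiniteDimensional ℚ_[p] L] [IsScalarTower (intermediateFieldIntegers p L) L (PadicAlgCl p)] in
/-- Unfolding lemma for membership in `jointClosure`. [folklore] -/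
theorem mem_jointClosure_iff (z : 𝓡₁.R × 𝓡₂.R) :
    z ∈ jointClosure L 𝓡₁ 𝓡₂ ↔ JointMem L 𝓡₁ 𝓡₂ z := Iff.rfl

omit [FiniteDimensional ℚ_[p] L] [IsScalarTower (intermediateFieldIntegers p L) L (PadicAlgCl p)] in
/-- The paired entries lie in `R₃`. [folklore] -/
theorem jointGen_mem_jointClosure (t : Γ × Fin n × Fin n) :
    jointGen L 𝓡₁ 𝓡₂ t ∈ jointClosure L 𝓡₁ 𝓡₂ :=
  jointMem_of_mem L 𝓡₁ 𝓡₂ (Algebra.subset_adjoin ⟨t, rfl⟩)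

omit [FiniteDimensional ℚ_[p] L] [IsScalarTower (intermediateFieldIntegers p L) L (PadicAlgCl p)] in
/-- Negation preserves `JointMem` (it is a subalgebra). [folklore] -/
theorem jointMem_neg {z : 𝓡₁.R × 𝓡₂.R} (hz : JointMem L 𝓡₁ 𝓡₂ z) : JointMem L 𝓡₁ 𝓡₂ (-z) :=
  (jointClosure L 𝓡₁ 𝓡₂).neg_mem hz

/-! ### Symmetry -/

omit [FiniteDimensional ℚ_[p] L] [IsScalarTower (intermediateFieldIntegers p L) L (PadicAlgCl p)] in
/-- `A(𝓡₂, 𝓡₁)` is the swap of `A(𝓡₁, 𝓡₂)`. [folklore] -/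
theorem mem_jointSubalgebra_swap {s : 𝓡₁.R × 𝓡₂.R} (hs : s ∈ jointSubalgebra L 𝓡₁ 𝓡₂) :
    s.swap ∈ jointSubalgebra L 𝓡₂ 𝓡₁ := by
  let e : (𝓡₁.R × 𝓡₂.R) →ₐ[intermediateFieldIntegers p L] (𝓡₂.R × 𝓡₁.R) :=
    (AlgHom.snd (intermediateFieldIntegers p L) 𝓡₁.R 𝓡₂.R).prod
      (AlgHom.fst (intermediateFieldIntegers p L) 𝓡₁.R 𝓡₂.R)
  have he : ∀ z : 𝓡₁.R × 𝓡₂.R, e z = z.swap := fun z => rfl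
  have hmap : (jointSubalgebra L 𝓡₁ 𝓡₂).map e ≤ jointSubalgebra L 𝓡₂ 𝓡₁ := by
    rw [jointSubalgebra, AlgHom.map_adjoin]
    refine Algebra.adjoin_le ?_
    rintro _ ⟨_, ⟨t, rfl⟩, rfl⟩
    exact Algebra.subset_adjoin ⟨t, rfl⟩
  rw [← he]
  exact hmap (Subalgebra.mem_map.mpr ⟨s, hs, rfl⟩)

omit [FiniteDimensional ℚ_[p] L] [IsScalarTower (intermediateFieldIntegers p L) L (PadicAlgCl p)] in
/-- `R₃(𝓡₂, 𝓡₁)` contains the swap of `R₃(𝓡₁, 𝓡₂)`. [folklore] -/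
theorem jointMem_swap {z : 𝓡₁.R × 𝓡₂.R} (hz : JointMem L 𝓡₁ 𝓡₂ z) :
    JointMem L 𝓡₂ 𝓡₁ z.swap := fun m => by
  obtain ⟨s, hs, hs1, hs2⟩ := hz m
  exact ⟨s.swap, mem_jointSubalgebra_swap L 𝓡₁ 𝓡₂ hs, hs2, hs1⟩

/-! ### Injectivity of the projections -/

/-- **`R₃ → R₁` detects `R₃ → R₂`**: if `z ∈ R₃` has `z.1 = 0` then `z.2 = 0`. For every point
`x₂` of `R₂`, the `𝒞`-lift `x₂ ∘ lift₂` defines a point `x₁` of `R₁` agreeing with `x₂` on `A`;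
continuity of both points along the level-`m` approximations gives `x₂ z.2 = 0`, and points
separate the elements of `R₂`. [cite: BarnetlambEtAl2014, §1.4] -/
theorem snd_eq_zero_of_fst_eq_zero [Finite k]
    (hk : Function.Surjective (algebraMap (intermediateFieldIntegers p L) k))
    {z : 𝓡₁.R × 𝓡₂.R} (hz : JointMem L 𝓡₁ 𝓡₂ z) (h1 : z.1 = 0) : z.2 = 0 := by
  refine eq_zero_of_forall_algHom_eq_zero L 𝓡₂.torsionFree
    (𝓡₂.residue_comp_algebraMap_surjective L hk) fun x₂ => ?_
  -- the companion point of `R₁`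
  set x₁ := 𝓡₁.pointOf (𝓡₂.liftAt x₂) (𝓡₂.reducesTo_liftAt x₂) (𝓡₂.cond_liftAt x₂) with hx₁
  have hx : ∀ (γ : Γ) (i j : Fin n), x₁ ((𝓡₁.lift γ : Matrix (Fin n) (Fin n) 𝓡₁.R) i j) =
      x₂ ((𝓡₂.lift γ : Matrix (Fin n) (Fin n) 𝓡₂.R) i j) :=
    fun γ i j => pointOf_liftAt_apply L 𝓡₁ 𝓡₂ x₂ γ i j
  obtain ⟨c₁, hc₁0, hc₁1, hc₁⟩ := 𝓡₁.exists_norm_pow_le L hk x₁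
  obtain ⟨c₂, hc₂0, hc₂1, hc₂⟩ := 𝓡₂.exists_norm_pow_le L hk x₂
  set c := max c₁ c₂ with hc
  have hc0 : 0 ≤ c := hc₁0.trans (le_max_left _ _)
  have hcl : c < 1 := max_lt hc₁1 hc₂1
  -- `‖x₂ z.2‖ ≤ cᵐ` for every `m`
  have hbound : ∀ m : ℕ, ‖x₂ z.2‖ ≤ c ^ m := fun m => by
    obtain ⟨s, hs, hs1, hs2⟩ := hz m
    rw [h1, zero_sub, Ideal.neg_mem_iff] at hs1
    have hdecomp : x₂ z.2 = x₂ (z.2 - s.2) + x₁ s.1 := by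
      rw [map_sub, apply_fst_eq_apply_snd_of_mem_jointSubalgebra L 𝓡₁ 𝓡₂ hx hs, sub_add_cancel]
    rw [hdecomp]
    refine (IsUltrametricDist.norm_add_le_max _ _).trans (max_le ?_ ?_)
    · exact (hc₂ m _ hs2).trans (pow_le_pow_left₀ hc₂0 (le_max_right _ _) m)
    · exact (hc₁ m _ hs1).trans (pow_le_pow_left₀ hc₁0 (le_max_left _ _) m)
  have hlim : Tendsto (fun m : ℕ => c ^ m) atTop (𝓝 0) :=
    tendsto_pow_atTop_nhds_zero_of_lt_one hc0 hcl
  have h0 : ‖x₂ z.2‖ ≤ 0 := ge_of_tendsto' hlim hbound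
  exact norm_le_zero_iff.mp h0

/-- Symmetrically: if `z ∈ R₃` has `z.2 = 0` then `z.1 = 0`. [cite: BarnetlambEtAl2014, §1.4] -/
theorem fst_eq_zero_of_snd_eq_zero [Finite k]
    (hk : Function.Surjective (algebraMap (intermediateFieldIntegers p L) k))
    {z : 𝓡₁.R × 𝓡₂.R} (hz : JointMem L 𝓡₁ 𝓡₂ z) (h2 : z.2 = 0) : z.1 = 0 :=
  snd_eq_zero_of_fst_eq_zero L 𝓡₂ 𝓡₁ hk (jointMem_swap L 𝓡₁ 𝓡₂ hz) h2

/-! ### Surjectivity of the projections -/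

omit [FiniteDimensional ℚ_[p] L] [IsScalarTower (intermediateFieldIntegers p L) L (PadicAlgCl p)] in
/-- **`R₃ → R₁` is onto.** Approximate `a ∈ R₁` by `s_m ∈ A` modulo `𝔪₁ᵐ` (density of the
entries, `exists_sub_mem`); an `𝔪₂`-adic cluster point `b` of `(s_m.2)` (sequential compactness
of `R₂`, finite residue field) gives `(a, b) ∈ R₃`. [cite: BarnetlambEtAl2014, §1.4] -/
theorem exists_jointMem_fst_eq [Finite k]
    (hk : Function.Surjective (algebraMap (intermediateFieldIntegers p L) k)) (a : 𝓡₁.R) :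
    ∃ b : 𝓡₂.R, JointMem L 𝓡₁ 𝓡₂ (a, b) := by
  classical
  -- level-`m` approximations of `a` inside `A`
  have happrox : ∀ m : ℕ, ∃ s ∈ jointSubalgebra L 𝓡₁ 𝓡₂, a - s.1 ∈ maximalIdeal 𝓡₁.R ^ m := by
    intro m
    obtain ⟨s', hs', hs'm⟩ := 𝓡₁.exists_sub_mem_pow m a
    rw [← map_fst_jointSubalgebra L 𝓡₁ 𝓡₂] at hs'
    obtain ⟨s, hs, rfl⟩ := Subalgebra.mem_map.mp hs'
    exact ⟨s, hs, hs'm⟩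
  choose s hs hsm using happrox
  -- a cluster point of the second coordinates
  haveI := 𝓡₂.finite_residueField L hk
  haveI : IsAdicComplete (maximalIdeal 𝓡₂.R) 𝓡₂.R := 𝓡₂.isAdicComplete
  obtain ⟨b, hb⟩ := CompleteLocalRing.exists_adicClusterPt (fun m => (s m).2)
  refine ⟨b, fun m => ?_⟩
  obtain ⟨m', hm', hbm⟩ := hb m m
  refine ⟨s m', hs m', ?_, ?_⟩
  · exact Ideal.pow_le_pow_right hm' (hsm m')
  · rw [← Ideal.neg_mem_iff, neg_sub]
    exact hbm

/-! ### The isomorphism -/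

/-- The first projection `R₃ → R₁`, an `𝒪`-algebra homomorphism. [folklore] -/
def fstHom : jointClosure L 𝓡₁ 𝓡₂ →ₐ[intermediateFieldIntegers p L] 𝓡₁.R :=
  (AlgHom.fst (intermediateFieldIntegers p L) 𝓡₁.R 𝓡₂.R).comp (jointClosure L 𝓡₁ 𝓡₂).val

/-- The second projection `R₃ → R₂`. [folklore] -/
def sndHom : jointClosure L 𝓡₁ 𝓡₂ →ₐ[intermediateFieldIntegers p L] 𝓡₂.R :=
  (AlgHom.snd (intermediateFieldIntegers p L) 𝓡₁.R 𝓡₂.R).comp (jointClosure L 𝓡₁ 𝓡₂).val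

/-- `R₃ → R₁` is bijective. [cite: BarnetlambEtAl2014, §1.4] -/
theorem fstHom_bijective [Finite k]
    (hk : Function.Surjective (algebraMap (intermediateFieldIntegers p L) k)) :
    Function.Bijective (fstHom L 𝓡₁ 𝓡₂) := by
  constructor
  · intro z w hzw
    have h : (z.1 - w.1).1 = 0 := sub_eq_zero.mpr hzw
    have h2 := snd_eq_zero_of_fst_eq_zero L 𝓡₁ 𝓡₂ hk ((jointClosure L 𝓡₁ 𝓡₂).sub_mem z.2 w.2) h
    refine Subtype.ext (Prod.ext hzw ?_)
    exact sub_eq_zero.mp h2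
  · intro a
    obtain ⟨b, hb⟩ := exists_jointMem_fst_eq L 𝓡₁ 𝓡₂ hk a
    exact ⟨⟨(a, b), hb⟩, rfl⟩

/-- `R₃ → R₂` is bijective. [cite: BarnetlambEtAl2014, §1.4] -/
theorem sndHom_bijective [Finite k]
    (hk : Function.Surjective (algebraMap (intermediateFieldIntegers p L) k)) :
    Function.Bijective (sndHom L 𝓡₁ 𝓡₂) := by
  constructor
  · intro z w hzw
    have h : (z.1 - w.1).2 = 0 := sub_eq_zero.mpr hzw
    have h1 := fst_eq_zero_of_snd_eq_zero L 𝓡₁ 𝓡₂ hk ((jointClosure L 𝓡₁ 𝓡₂).sub_mem z.2 w.2) h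
    refine Subtype.ext (Prod.ext ?_ hzw)
    exact sub_eq_zero.mp h1
  · intro b
    obtain ⟨a, ha⟩ := exists_jointMem_fst_eq L 𝓡₂ 𝓡₁ hk b
    refine ⟨⟨(a, b), ?_⟩, rfl⟩
    have := jointMem_swap L 𝓡₂ 𝓡₁ ha
    exact this

/-- **Rigidity ([BLGGT] §1.4 "uniquely characterized")**: any two pointwise lifting rings over
`𝒪_L` with the same parameters `(Γ, ρ̄, 𝒞)` — reduced, `p`-torsion-free, complete noetherian local
with residue field `k_L`, topologically generated by a lifting of `ρ̄` whose `ℚ̄_p`-specialisations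
are exactly the `𝒞`-lifts — are isomorphic as `𝒪_L`-algebras (`R₁ ≅ R₃ ≅ R₂`).
[cite: BarnetlambEtAl2014, §1.4] [cite: Kisin2007, (3.3.3)] -/
def algEquiv [Finite k] (hk : Function.Surjective (algebraMap (intermediateFieldIntegers p L) k)) :
    𝓡₁.R ≃ₐ[intermediateFieldIntegers p L] 𝓡₂.R :=
  (AlgEquiv.ofBijective (fstHom L 𝓡₁ 𝓡₂) (fstHom_bijective L 𝓡₁ 𝓡₂ hk)).symm.trans
    (AlgEquiv.ofBijective (sndHom L 𝓡₁ 𝓡₂) (sndHom_bijective L 𝓡₁ 𝓡₂ hk))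

/-- The isomorphism on elements of `R₃`: `algEquiv z.1 = z.2`. [folklore] -/
theorem algEquiv_apply_fst [Finite k]
    (hk : Function.Surjective (algebraMap (intermediateFieldIntegers p L) k))
    (z : jointClosure L 𝓡₁ 𝓡₂) : algEquiv L 𝓡₁ 𝓡₂ hk z.1.1 = z.1.2 := by
  have h1 : (AlgEquiv.ofBijective (fstHom L 𝓡₁ 𝓡₂) (fstHom_bijective L 𝓡₁ 𝓡₂ hk)).symm z.1.1 = z :=
    (AlgEquiv.symm_apply_eq _).mpr rfl
  simp only [algEquiv, AlgEquiv.trans_apply, h1]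
  rfl

/-- **The isomorphism carries `lift₁` to `lift₂`** entrywise. [cite: BarnetlambEtAl2014, §1.4] -/
theorem algEquiv_lift [Finite k]
    (hk : Function.Surjective (algebraMap (intermediateFieldIntegers p L) k)) (γ : Γ) (i j : Fin n) :
    algEquiv L 𝓡₁ 𝓡₂ hk ((𝓡₁.lift γ : Matrix (Fin n) (Fin n) 𝓡₁.R) i j) =
      (𝓡₂.lift γ : Matrix (Fin n) (Fin n) 𝓡₂.R) i j :=
  algEquiv_apply_fst L 𝓡₁ 𝓡₂ hk ⟨jointGen L 𝓡₁ 𝓡₂ (γ, i, j), jointGen_mem_jointClosure L 𝓡₁ 𝓡₂ _⟩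

/-- The isomorphism carries `lift₁` to `lift₂` as homomorphisms `Γ → GL_n`. [cite: BarnetlambEtAl2014, §1.4] -/
theorem map_algEquiv_comp_lift [Finite k]
    (hk : Function.Surjective (algebraMap (intermediateFieldIntegers p L) k)) :
    (Matrix.GeneralLinearGroup.map
      ((algEquiv L 𝓡₁ 𝓡₂ hk : 𝓡₁.R ≃ₐ[intermediateFieldIntegers p L] 𝓡₂.R) : 𝓡₁.R →+* 𝓡₂.R)).comp
        𝓡₁.lift = 𝓡₂.lift := by
  refine MonoidHom.ext fun γ => Units.ext (Matrix.ext fun i j => ?_)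
  exact algEquiv_lift L 𝓡₁ 𝓡₂ hk γ i j

/-! ### Transport of generic-fibre properties -/

/-- The induced isomorphism of the generic fibres `R₁[1/p] ≅ R₂[1/p]`. [folklore] -/
def awayEquiv [Finite k] (hk : Function.Surjective (algebraMap (intermediateFieldIntegers p L) k)) :
    Localization.Away (p : 𝓡₁.R) ≃+* Localization.Away (p : 𝓡₂.R) :=
  IsLocalization.ringEquivOfRingEquiv (M := Submonoid.powers (p : 𝓡₁.R))
    (T := Submonoid.powers (p : 𝓡₂.R)) (Localization.Away (p : 𝓡₁.R))
    (Localization.Away (p : 𝓡₂.R)) (algEquiv L 𝓡₁ 𝓡₂ hk).toRingEquiv (by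
      rw [Submonoid.map_powers]
      simp)

/-- **Regularity of the generic fibre is independent of the instance.** [cite: Kisin2007, Thm. 3.3.8] -/
theorem isRegularRing_away_of_algEquiv [Finite k]
    (hk : Function.Surjective (algebraMap (intermediateFieldIntegers p L) k))
    (h : IsRegularRing (Localization.Away (p : 𝓡₁.R))) :
    IsRegularRing (Localization.Away (p : 𝓡₂.R)) :=
  IsRegularRing.of_ringEquiv (awayEquiv L 𝓡₁ 𝓡₂ hk)

/-- **Equidimensionality of the generic fibre is independent of the instance.**
[cite: Kisin2007, Thm. 3.3.8] -/
theorem forall_ringKrullDim_quotient_minimalPrimes_away_of_algEquiv [Finite k]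
    (hk : Function.Surjective (algebraMap (intermediateFieldIntegers p L) k)) {d : WithBot ℕ∞}
    (h : ∀ 𝔮 ∈ minimalPrimes (Localization.Away (p : 𝓡₁.R)),
      ringKrullDim (Localization.Away (p : 𝓡₁.R) ⧸ 𝔮) = d) :
    ∀ 𝔮 ∈ minimalPrimes (Localization.Away (p : 𝓡₂.R)),
      ringKrullDim (Localization.Away (p : 𝓡₂.R) ⧸ 𝔮) = d :=
  Literature.AlgebraicGeometry.Resolution.forall_ringKrullDim_quotient_minimalPrimes_of_ringEquiv
    (awayEquiv L 𝓡₁ 𝓡₂ hk) h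

/-- **Kisin-type generic-fibre statements transfer between instances**: "`R[1/p]` is regular and
every irreducible component of `Spec R[1/p]` has dimension `d`" holds for `𝓡₂` as soon as it
holds for `𝓡₁` — the shape of the accepted predicate
`PstWeilDeligneData.CrystallineGenericFibreRegular`, which is therefore a statement about THE
ring `R^□_{𝒪,ρ̄,𝒞}` ([BLGGT] §1.4) although it quantifies over all instances.
[cite: Kisin2007, Thm. 3.3.8] [cite: BarnetlambEtAl2014, §1.4] -/
theorem genericFibre_transport [Finite k]
    (hk : Function.Surjective (algebraMap (intermediateFieldIntegers p L) k)) {d : WithBot ℕ∞}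
    (h : IsRegularRing (Localization.Away (p : 𝓡₁.R)) ∧
      ∀ 𝔮 ∈ minimalPrimes (Localization.Away (p : 𝓡₁.R)),
        ringKrullDim (Localization.Away (p : 𝓡₁.R) ⧸ 𝔮) = d) :
    IsRegularRing (Localization.Away (p : 𝓡₂.R)) ∧
      ∀ 𝔮 ∈ minimalPrimes (Localization.Away (p : 𝓡₂.R)),
        ringKrullDim (Localization.Away (p : 𝓡₂.R) ⧸ 𝔮) = d :=
  ⟨isRegularRing_away_of_algEquiv L 𝓡₁ 𝓡₂ hk h.1,
    forall_ringKrullDim_quotient_minimalPrimes_away_of_algEquiv L 𝓡₁ 𝓡₂ hk h.2⟩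

end TwoRings

end PointwiseLiftingRing

end Literature.NumberTheory.GaloisRepresentations

end
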